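import Mathlib
import HarnessLib
import Summits.ResolutionOfSingularities.ResolutionOfSingularities.Theorems.HomologicalConductorPersistenceLostCertificate

/-!
# R4 LOST half for all `r`: the generic Knörrer double of the lattice `(K[t]^k, z ↦ N)` over
# `A_r × line = K[x,y,z,t] ⧸ (xy − z^{r+1})`, and `z^a ∉ caⁿ` from a curve-level non-certificate

Route `ResolutionOfSingularities/HomologicalConductor`, chain W4.4b (crux `Persistence`
stmt-ResolutionOfSingularities-16484), CHAIN v13.1 §H2L object **(ζ)** (res-L1-w44b-plan-1 CUTS
2026-08-27T10:27:28Z (2)), res-D-pv-026.  [OURS · L1 w44b; AI-written, weaker than expert review; NOT a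
statement of the manuscript under study, and no statement of that manuscript is used.]

§0 (dependency-free): for ANY commutative ring `S`, elements `x y z : S`, `r : ℕ` and ANY square matrix
`N` over `S` with `N^(r+1) = 0`, the pair `φ := z•1 − N`, `ψ := Σ_{j ≤ r} z^{r−j} • N^j` is a matrix
factorisation of `z^{r+1}` (`φψ = ψφ = z^{r+1}•1`, `Commute.mul_geom_sum₂`), and its KNÖRRER DOUBLE
`Φ := [[φ, −x•1],[y•1, −ψ]]`, `Ψ := [[−ψ, x•1],[−y•1, φ]]` (as `Matrix.fromBlocks`) is a matrix
factorisation of `xy − z^{r+1}` (`ΦΨ = ΨΦ = (xy − z^{r+1})•1`). With `N = t^γ • J_k` (`J_k` the nilpotent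
Jordan block, `k ≤ r+1`) over `S = K[x,y,z,t]` this is the witness family of U12-SPEC v2 §4/§6 (U12 =
the case `r = 3`, `k = 3`, `γ = 1`).

§1: the §H2L criterion for the double — `pow_not_mem_cohomologyAnnihilatorOfDegree_of_not_exists_certificate`:
no certificate `c•1 = GΨ + ΦE` ⇒ `c̄ ∉ caⁿ(S ⧸ (xy − z^{r+1}))` for every `n` (det-free U10 twin p522303 +
U7c p520525, via `LostCertificate`/`LostAssembly`), for `S` noetherian and `xy − z^{r+1} ∈ S⁰`.

The curve-level input (no certificate for `z^a t^c` over `(φ, ψ)`: U14 = res-D-pv-058's lattice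
divisibility, U13 = res-type-010's Knörrer certificate transfer) is consumed BY NAME in the follow-up file
once both have landed; here it enters §2 as the hypothesis `hcert`.
-/

noncomputable section

-- single-problem summit: the doubled namespace component `ResolutionOfSingularities` is forced
set_option linter.dupNamespace false

namespace Summit.ResolutionOfSingularities.ResolutionOfSingularities.Theorems.HomologicalConductor.LossAr

open Literature.RingTheory.CohomologyAnnihilator
open Summit.ResolutionOfSingularities.ResolutionOfSingularities.Theorems.HomologicalConductor.LostAssembly
open Summit.ResolutionOfSingularities.ResolutionOfSingularities.Theorems.HomologicalConductor.PersistenceStableAnnihilatorMF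
open Summit.ResolutionOfSingularities.ResolutionOfSingularities.Theorems.HomologicalConductor.MFCoker
open Matrix

universe u

/-! ## §0 The matrix factorisation of `z^{r+1}` attached to a nilpotent matrix, and its Knörrer double -/

section Double

variable {S : Type u} [CommRing S] {ι : Type} [Fintype ι] [DecidableEq ι]

/-- `φ_N = z•1 − N`. [OURS · L1 w44b] -/
def phiN (z : S) (N : Matrix ι ι S) : Matrix ι ι S := z • (1 : Matrix ι ι S) - N

/-- `ψ_N = Σ_{j ≤ r} z^{r−j} • N^j`. [OURS · L1 w44b] -/
def psiN (z : S) (r : ℕ) (N : Matrix ι ι S) : Matrix ι ι S :=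
  ∑ j ∈ Finset.range (r + 1), z ^ (r - j) • N ^ j

/-- `ψ_N` at `r = 0` is the identity. [OURS · L1 w44b] -/
theorem psiN_zero (z : S) (N : Matrix ι ι S) : psiN z 0 N = 1 := by
  simp [psiN]

/-- The recursion `ψ_{r+1} = z • ψ_r + N^{r+1}`. [OURS · L1 w44b] -/
theorem psiN_succ (z : S) (r : ℕ) (N : Matrix ι ι S) :
    psiN z (r + 1) N = z • psiN z r N + N ^ (r + 1) := by
  rw [psiN, Finset.sum_range_succ, Nat.sub_self, pow_zero, one_smul, psiN, Finset.smul_sum]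
  congr 1
  refine Finset.sum_congr rfl fun j hj => ?_
  rw [Finset.mem_range] at hj
  rw [smul_smul, ← pow_succ', Nat.sub_add_comm (by omega)]

/-- **`(z•1 − N) ψ_N = z^{r+1}•1 − N^{r+1}`** (telescoping; no hypothesis on `N`). [OURS · L1 w44b] -/
theorem phiN_mul_psiN_eq (z : S) (r : ℕ) (N : Matrix ι ι S) :
    phiN z N * psiN z r N = z ^ (r + 1) • (1 : Matrix ι ι S) - N ^ (r + 1) := by
  induction r with
  | zero => rw [psiN_zero, Matrix.mul_one, phiN, pow_one, pow_one]
  | succ r ih =>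
    rw [psiN_succ, Matrix.mul_add, Matrix.mul_smul, ih, phiN, Matrix.sub_mul, Matrix.smul_mul, Matrix.one_mul,
      smul_sub, smul_smul, ← pow_succ', ← pow_succ', pow_succ N (r + 1)]
    abel

/-- **`ψ_N (z•1 − N) = z^{r+1}•1 − N^{r+1}`.** [OURS · L1 w44b] -/
theorem psiN_mul_phiN_eq (z : S) (r : ℕ) (N : Matrix ι ι S) :
    psiN z r N * phiN z N = z ^ (r + 1) • (1 : Matrix ι ι S) - N ^ (r + 1) := by
  induction r with
  | zero => rw [psiN_zero, Matrix.one_mul, phiN, pow_one, pow_one]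
  | succ r ih =>
    rw [psiN_succ, Matrix.add_mul, Matrix.smul_mul, ih, phiN, Matrix.mul_sub, Matrix.mul_smul, Matrix.mul_one,
      smul_sub, smul_smul, ← pow_succ', ← pow_succ]
    abel

/-- **`φ_N ψ_N = z^{r+1}•1`** when `N^{r+1} = 0`. [OURS · L1 w44b] -/
theorem phiN_mul_psiN (z : S) (r : ℕ) (N : Matrix ι ι S) (hN : N ^ (r + 1) = 0) :
    phiN z N * psiN z r N = z ^ (r + 1) • (1 : Matrix ι ι S) := by
  rw [phiN_mul_psiN_eq, hN, sub_zero]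

/-- **`ψ_N φ_N = z^{r+1}•1`** when `N^{r+1} = 0`. [OURS · L1 w44b] -/
theorem psiN_mul_phiN (z : S) (r : ℕ) (N : Matrix ι ι S) (hN : N ^ (r + 1) = 0) :
    psiN z r N * phiN z N = z ^ (r + 1) • (1 : Matrix ι ι S) := by
  rw [psiN_mul_phiN_eq, hN, sub_zero]

/-- The KNÖRRER DOUBLE `Φ = [[φ, −x•1],[y•1, −ψ]]`. [OURS · L1 w44b · U12-SPEC §1 pattern] -/
def Phi (x y z : S) (r : ℕ) (N : Matrix ι ι S) : Matrix (ι ⊕ ι) (ι ⊕ ι) S :=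
  Matrix.fromBlocks (phiN z N) (-(x • (1 : Matrix ι ι S))) (y • (1 : Matrix ι ι S)) (-(psiN z r N))

/-- The KNÖRRER DOUBLE `Ψ = [[−ψ, x•1],[−y•1, φ]]`. [OURS · L1 w44b · U12-SPEC §1 pattern] -/
def Psi (x y z : S) (r : ℕ) (N : Matrix ι ι S) : Matrix (ι ⊕ ι) (ι ⊕ ι) S :=
  Matrix.fromBlocks (-(psiN z r N)) (x • (1 : Matrix ι ι S)) (-(y • (1 : Matrix ι ι S))) (phiN z N)

/-- **`Φ Ψ = (xy − z^{r+1})•1`.** [OURS · L1 w44b] -/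
theorem Phi_mul_Psi (x y z : S) (r : ℕ) (N : Matrix ι ι S) (hN : N ^ (r + 1) = 0) :
    Phi x y z r N * Psi x y z r N = (x * y - z ^ (r + 1)) • (1 : Matrix (ι ⊕ ι) (ι ⊕ ι) S) := by
  have h1 := phiN_mul_psiN z r N hN
  have h2 := psiN_mul_phiN z r N hN
  rw [Phi, Psi, Matrix.fromBlocks_multiply, ← Matrix.fromBlocks_one, Matrix.fromBlocks_smul, smul_zero]
  simp only [Matrix.mul_neg, Matrix.neg_mul, Matrix.smul_mul, Matrix.mul_smul, Matrix.one_mul,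
    Matrix.mul_one, h1, h2]
  congr 1
  · module
  · module
  · module
  · module

/-- **`Ψ Φ = (xy − z^{r+1})•1`.** [OURS · L1 w44b] -/
theorem Psi_mul_Phi (x y z : S) (r : ℕ) (N : Matrix ι ι S) (hN : N ^ (r + 1) = 0) :
    Psi x y z r N * Phi x y z r N = (x * y - z ^ (r + 1)) • (1 : Matrix (ι ⊕ ι) (ι ⊕ ι) S) := by
  have h1 := phiN_mul_psiN z r N hN
  have h2 := psiN_mul_phiN z r N hN
  rw [Phi, Psi, Matrix.fromBlocks_multiply, ← Matrix.fromBlocks_one, Matrix.fromBlocks_smul, smul_zero]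
  simp only [Matrix.mul_neg, Matrix.neg_mul, Matrix.smul_mul, Matrix.mul_smul, Matrix.one_mul,
    Matrix.mul_one, h1, h2]
  congr 1
  · module
  · module
  · module
  · module

end Double

/-! ## §1 The double re-indexed by `Fin (k + k)` and the §H2L criterion for it -/

section Criterion

variable {S : Type u} [CommRing S] {k : ℕ}

/-- `Φ` re-indexed by `Fin (k + k)` (the currency of `MFCoker`/`LostAssembly`). [OURS · L1 w44b] -/
def PhiFin (x y z : S) (r : ℕ) (N : Matrix (Fin k) (Fin k) S) : Matrix (Fin (k + k)) (Fin (k + k)) S :=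
  Matrix.reindex finSumFinEquiv finSumFinEquiv (Phi x y z r N)

/-- `Ψ` re-indexed by `Fin (k + k)`. [OURS · L1 w44b] -/
def PsiFin (x y z : S) (r : ℕ) (N : Matrix (Fin k) (Fin k) S) : Matrix (Fin (k + k)) (Fin (k + k)) S :=
  Matrix.reindex finSumFinEquiv finSumFinEquiv (Psi x y z r N)

/-- `Φ Ψ = (xy − z^{r+1})•1` after re-indexing. [OURS · L1 w44b] -/
theorem PhiFin_mul_PsiFin (x y z : S) (r : ℕ) (N : Matrix (Fin k) (Fin k) S) (hN : N ^ (r + 1) = 0) :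
    PhiFin x y z r N * PsiFin x y z r N = (x * y - z ^ (r + 1)) • (1 : Matrix (Fin (k + k)) (Fin (k + k)) S) := by
  rw [PhiFin, PsiFin, Matrix.reindex_apply, Matrix.reindex_apply, Matrix.submatrix_mul_equiv,
    Phi_mul_Psi x y z r N hN]
  ext i j
  simp [Matrix.one_apply]

/-- `Ψ Φ = (xy − z^{r+1})•1` after re-indexing. [OURS · L1 w44b] -/
theorem PsiFin_mul_PhiFin (x y z : S) (r : ℕ) (N : Matrix (Fin k) (Fin k) S) (hN : N ^ (r + 1) = 0) :
    PsiFin x y z r N * PhiFin x y z r N = (x * y - z ^ (r + 1)) • (1 : Matrix (Fin (k + k)) (Fin (k + k)) S) := by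
  rw [PhiFin, PsiFin, Matrix.reindex_apply, Matrix.reindex_apply, Matrix.submatrix_mul_equiv,
    Psi_mul_Phi x y z r N hN]
  ext i j
  simp [Matrix.one_apply]

/-- **The §H2L criterion for the Knörrer double of a nilpotent matrix** (det-free U10 ∘ U7c): `S`
noetherian, `xy − z^{r+1} ∈ S⁰`, `N^{r+1} = 0`; if `c•1 = G·Ψ + Φ·E` has no solution then
`c̄ ∉ caⁿ(S ⧸ (xy − z^{r+1}))` for every `n`. [OURS · L1 w44b] -/
theorem not_mem_cohomologyAnnihilatorOfDegree_of_not_exists_certificate [IsNoetherianRing S]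
    (x y z : S) (r : ℕ) (N : Matrix (Fin k) (Fin k) S) (hN : N ^ (r + 1) = 0)
    (hf : x * y - z ^ (r + 1) ∈ nonZeroDivisors S) (c : S)
    (hcert : ¬ ∃ G E : Matrix (Fin (k + k)) (Fin (k + k)) S,
      c • (1 : Matrix (Fin (k + k)) (Fin (k + k)) S) = G * PsiFin x y z r N + PhiFin x y z r N * E)
    (n : ℕ) :
    Ideal.Quotient.mk (Ideal.span ({x * y - z ^ (r + 1)} : Set S)) c ∉
      cohomologyAnnihilatorOfDegree (S ⧸ Ideal.span ({x * y - z ^ (r + 1)} : Set S)) n :=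
  not_mem_cohomologyAnnihilatorOfDegree_of_no_certificate' (x * y - z ^ (r + 1)) hf (PhiFin x y z r N)
    (PsiFin x y z r N) (PhiFin_mul_PsiFin x y z r N hN) (PsiFin_mul_PhiFin x y z r N hN) c
    (fun h => exists_eq_of_stablyAnnihilates_coker (x * y - z ^ (r + 1)) hf (PhiFin x y z r N)
      (PsiFin x y z r N) (PhiFin_mul_PsiFin x y z r N hN) c h) hcert n

end Criterion

end Summit.ResolutionOfSingularities.ResolutionOfSingularities.Theorems.HomologicalConductor.LossAr

end
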